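import Summits.HodgeConjecture.FermatCycles.ConditionQSymmetric
import Literature.AlgebraicGeometry.HodgeTheory.FermatAokiStandardCharacter
import HarnessLib

/-!
# `(Q⁴ₘ)` fails for every `m` prime to `6` and divisible by `5` — Shioda's 1981 symmetry argument, uniformly, from two printed theorems (part 2 of 2: Aoki's `σ_{p,1}`; the corollaries)

HONEST FRAMING: explicit algebraic cycles for specific Hodge classes on Fermat/Delsarte varieties;
residual open instances listed; no claim on general Hodge.

Topic path `Summits/HodgeConjecture/FermatCycles/` of cell `pub-hfermat` (new work, not literature: a structural by-product of the cell's `(Q⁴ₘ)`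
table, found from the kernel certificates `ConditionQObstruction*.lean` — at every FALSE level `5p ≤ 100` the separating functional is an
ASYMMETRY `e₋ₓ − eₓ`, and a check by two implementations (`code/lit/q4/symtest.py`, `sepfunc2.py`) showed that at `m = 25, 35, 55, 65, 85, 95` EVERY
generator of Shioda's `M'ₘ` is symmetric, exactly as in Shioda's printed proof for `m = 25` [Shioda1981FermatType, Appendix]).

THE ARGUMENT (ours; the two inputs are printed theorems, taken here as HYPOTHESES spelled out in the tree's vocabulary — nothing is vendored as a fact).
Let `gcd(m, 6) = 1`.
* INPUT 1 = [Shioda1982PicardFermat] Theorem K-R (a), p. 730 (= [KoblitzRohrlich1978] Thm 1 (i)): for `β, γ ∈ 𝔄^{1,0}ₘ` (triples of non-zero residues with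
  `⟨b₀⟩ + ⟨b₁⟩ + ⟨b₂⟩ = m`) with `H_β = H_γ` (`H_β = {t ∈ (ℤ/m)ˣ : |t·β| = 1}`), `β` is a permutation of `γ`. Hypothesis `hKR` below.
* INPUT 2 = [Shioda1982PicardFermat] Theorem 6 (a), p. 731: there are no indecomposable elements of `𝔅²ₘ` — every Hodge quadruple has two entries
  summing to `0` (§2 p. 726), i.e. is `{a, −a} + {b, −b}`. Hypothesis `h6a` below.
* STEP (`mPrime_symmetric`): every element of `M'ₘ = ⟨pairs, Hodge quadruples, semi-decomposable Hodge sextuples⟩` is SYMMETRIC (`x_ν = x_{m−ν}`, the tree's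
  `Shioda1981.IsSymmetric`). Pairs and (by INPUT 2) quadruples are; a semi-decomposable Hodge sextuple is `T₁ + T₂` with zero-sum triples `Tᵢ` of
  non-zero residues, and Shioda's equations (2) for `T₁ + T₂` say `|tT₁| + |tT₂| = 3` for every unit `t`, i.e. `H_{T₂} = H_{−T₁}` (after arranging
  `|T₂| = 1`); INPUT 1 gives `T₂ = −T₁` as multisets (`semi_eq_add_neg`), so `T₁ + T₂` is symmetric.
* CONSEQUENCES: a NON-symmetric Hodge multiset is not `ξ₁ − ξ₂` with `ξᵢ ∈ M'ₘ` (`not_stablyMem_of_not_symmetric`), so it refutes `(Qₘ)`, and `(Q⁴ₘ)` if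
  it has `6` elements (`not_conditionQ_four_of_not_symmetric`). THIS FILE uses the tree's explicit Aoki character
  `FermatCharacter.aokiStandard r m 1 = σ_{p,1} = (1, 1+d, …, 1+(p−1)d, −p)`, `p = 2r+1`, `d = m/p` ([Aoki1987] §1 p. 387; its multiset of values is
  Hodge by the tree's `isHodgeMultiset_pStandard`, [Aoki1983] Prop. 5.1): for `p ∣ m` and `m/p ≥ 3` it contains `1` but not `−1`
  (`neg_one_not_mem_aokiStandard_one`), so it is NOT symmetric; hence (`not_conditionQ_of_odd_dvd`) `(Qⁿₘ)` fails for `n ≥ p − 1 ≥ 4`, and in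
  particular **`not_conditionQ_four_of_five_dvd`: `(Q⁴ₘ)` FAILS for every `m` with `5 ∣ m`, `m ≥ 15`, granted the two inputs at that `m`** (printed
  theorems when `gcd(m, 6) = 1`: so for `m = 25, 35, 55, 65, 85, 95, 115, 125, 145, …`, every `m = 5p`, `p ≥ 5` prime); the kernel certificates of
  the cell at `25, 35, 55, 65, 85, 95` are its first instances, Shioda's Appendix (`m = 25`) its prototype.
* `conditionQAll_iff_prime`: since for `m` prime `(Pₘ)` holds (Parry; tree `shiodaCondition_of_prime`) and for composite `m` prime to `6` a prime `p ∣ m`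
  (`p ≥ 5`, `m/p ≥ 5`) gives the non-symmetric Hodge multiset `σ_{p,1}`, the same inputs give **`(Qₘ) ⟺ m` prime** for `gcd(m,6) = 1` — with
  `(Pₘ) ⇒ (Qₘ)` and Parry: `(Qₘ) ⟺ (Pₘ) ⟺ m` prime (`shiodaCondition_iff_prime_of_inputs`). Shioda's question (Math. Ann. 245 p. 184, "(Qₘ) but not (Pₘ)?") thus has a NEGATIVE answer throughout
  `gcd(m, 6) = 1` (granted the two printed theorems), consistent with the cell's table, all of whose twenty `(Q⁴) ∧ ¬(P⁴)` levels `m ≤ 100` are even.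

References: [Shioda1982PicardFermat] T. Shioda, On the Picard number of a Fermat surface, J. Fac. Sci. Univ. Tokyo IA 28 (1982) 725–734, Thm K-R p. 730,
§2 p. 726, Thm 6 p. 731 (scan read, `HOME/lit/scans/Shioda1982/`); [KoblitzRohrlich1978] N. Koblitz, D. Rohrlich, Canad. J. Math. 30 (1978) 1183–1205,
Thm 1 p. 1185; [Shioda1981FermatType] T. Shioda, Math. Ann. 258 (1981), Appendix pp. 78–79; [Shioda1979HodgeFermat] T. Shioda, Math. Ann. 245 (1979) §4
pp. 183–184; [Aoki1987] N. Aoki, J. Math. Soc. Japan 39 (1987) §1 p. 387, Thm 1-1; [Aoki1983] N. Aoki, Math. Ann. 266 (1983) Prop. 5.1 p. 36.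
-/

namespace Summit.HodgeConjecture.FermatCycles.ConditionQCoprimeSix

open Summit.HodgeConjecture.FermatCycles.ConditionQSymmetric

open Multiset
open Literature.AlgebraicGeometry.HodgeTheory Literature.AlgebraicGeometry.HodgeTheory.FermatCharacter
open Literature.AlgebraicGeometry.Shioda1979 Literature.AlgebraicGeometry.Shioda1981

variable {m : ℕ}

/-! ### Aoki's `σ_{p,1}` (the tree's `aokiStandard r m 1`, `p = 2r + 1`) is a non-symmetric Hodge multiset -/

/-- The multiset of values of `σ_{p,1}` is a Hodge multiset when `p = 2r+1 ∣ m` and `p < m` (so `p · 1 ≠ 0` in `ℤ/m`).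
[cite: Aoki1983, §5 Prop. 5.1 (p. 36)] [cite: Aoki1987, §1 p. 387] -/
theorem isHodgeMultiset_aokiStandard_one [NeZero m] {r : ℕ} (hpm : 2 * r + 1 ∣ m) (hlt : 2 * r + 1 < m) :
    IsHodgeMultiset (Finset.univ.val.map (aokiStandard r m 1)) := by
  rw [univ_val_map_aokiStandard]
  refine isHodgeMultiset_pStandard (p := 2 * r + 1) (r := r) rfl hpm (a := 1) ?_
  rw [mul_one]
  intro h
  have hdvd := (ZMod.natCast_eq_zero_iff _ _).1 h
  exact absurd (Nat.le_of_dvd (by omega) hdvd) (by omega)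

/-- `σ_{p,1}` has `p + 1 = 2r + 2` entries. [cite: Aoki1987, §1 p. 387] -/
theorem card_aokiStandard_one (r : ℕ) : card (Finset.univ.val.map (aokiStandard r m 1)) = 2 * r + 2 := by
  simp

/-- `1 ∈ σ_{p,1}` (its first entry). [cite: Aoki1987, §1 p. 387] -/
theorem one_mem_aokiStandard_one (r : ℕ) : (1 : ZMod m) ∈ Finset.univ.val.map (aokiStandard r m 1) := by
  rw [univ_val_map_aokiStandard]
  exact Multiset.mem_add.mpr (Or.inl (Multiset.mem_map.mpr ⟨0, Multiset.mem_range.mpr (by omega), by simp⟩))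

/-- `−1 ∉ σ_{p,1}` when `p = 2r+1 ≥ 3`, `p ∣ m` and `m/p ≥ 3`: `−1 = 1 + i d` would give `m ∣ 2 + i d ≤ 2 + m − d < m`, and `−1 = −p` would
give `m ∣ p − 1`. [folklore] -/
theorem neg_one_not_mem_aokiStandard_one [NeZero m] {r : ℕ} (hr : 1 ≤ r) (hpm : 2 * r + 1 ∣ m) (hd : 3 ≤ m / (2 * r + 1)) :
    (-1 : ZMod m) ∉ Finset.univ.val.map (aokiStandard r m 1) := by
  rw [univ_val_map_aokiStandard]
  generalize hp : 2 * r + 1 = p at hpm hd ⊢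
  have hp2 : 2 ≤ p := by omega
  clear hp hr
  obtain ⟨d, rfl⟩ := hpm
  have hp0 : 0 < p := by omega
  have hdd : p * d / p = d := Nat.mul_div_cancel_left d hp0
  rw [hdd] at hd
  intro h
  simp only [hdd, Multiset.mem_add, Multiset.mem_map, Multiset.mem_range, Multiset.mem_singleton, mul_one] at h
  rcases h with ⟨i, hi, he⟩ | h
  · have e : ((2 + i * d : ℕ) : ZMod (p * d)) = 0 := by
      push_cast; linear_combination he
    have hdvd := (ZMod.natCast_eq_zero_iff _ _).1 e
    have hle := Nat.le_of_dvd (by omega) hdvd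
    have h1 : i * d ≤ (p - 1) * d := Nat.mul_le_mul_right d (by omega)
    have hsub : (p - 1) * d = p * d - d := by rw [Nat.sub_mul, one_mul]
    have h4 : d ≤ p * d := Nat.le_mul_of_pos_left d hp0
    clear hdd hdvd e he
    omega
  · have e : ((p - 1 : ℕ) : ZMod (p * d)) = 0 := by
      rw [Nat.cast_sub (by omega)]; push_cast; linear_combination h
    have hdvd := (ZMod.natCast_eq_zero_iff _ _).1 e
    have hle := Nat.le_of_dvd (by omega) hdvd
    have h4 : 3 * p ≤ p * d := by nlinarith
    omega

/-- `σ_{p,1}` is not symmetric (`1 ∈ σ_{p,1}`, `−1 ∉ σ_{p,1}`). [folklore] -/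
theorem not_isSymmetric_aokiStandard_one [NeZero m] {r : ℕ} (hr : 1 ≤ r) (hpm : 2 * r + 1 ∣ m) (hd : 3 ≤ m / (2 * r + 1)) :
    ¬ IsSymmetric (Finset.univ.val.map (aokiStandard r m 1)) := by
  intro hs
  have h1 : 1 ≤ count (1 : ZMod m) (Finset.univ.val.map (aokiStandard r m 1)) :=
    Multiset.one_le_count_iff_mem.mpr (one_mem_aokiStandard_one r)
  have h2 : count (-1 : ZMod m) (Finset.univ.val.map (aokiStandard r m 1)) = 0 :=
    Multiset.count_eq_zero.mpr (neg_one_not_mem_aokiStandard_one hr hpm hd)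
  have := hs 1
  omega

/-! ### The corollaries, granted the two printed inputs (section variables as in part 1) -/

section Inputs

variable (hKR : ∀ β γ : Multiset (ZMod m), card β = 3 → card γ = 3 → (∀ x ∈ β, x ≠ 0) → (∀ x ∈ γ, x ≠ 0) →
    mNormSum β = m → mNormSum γ = m →
    (∀ t : (ZMod m)ˣ, mNormSum (β.map fun a ↦ (t : ZMod m) * a) = m ↔ mNormSum (γ.map fun a ↦ (t : ZMod m) * a) = m) → β = γ)
  (h6a : ∀ q : Multiset (ZMod m), IsHodgeMultiset q → card q = 4 → ∃ a b : ZMod m, q = {a, -a} + {b, -b})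

include hKR h6a

/-- `σ_{p,1}` is not stably in `M'ₘ` (`p = 2r+1 ≥ 3`, `p ∣ m`, `m/p ≥ 3`), granted the inputs at `m`.
[cite: Shioda1979HodgeFermat, §4 condition (Qₘ), p. 183] [cite: Shioda1982PicardFermat, Thm K-R (a) p. 730, Thm 6 (a) p. 731] -/
theorem not_stablyMem_aokiStandard_one [NeZero m] {r : ℕ} (hr : 1 ≤ r) (hpm : 2 * r + 1 ∣ m) (hd : 3 ≤ m / (2 * r + 1)) :
    ¬ ∃ ξ₁ ∈ MPrime m, ∃ ξ₂ ∈ MPrime m, Finset.univ.val.map (aokiStandard r m 1) + ξ₂ = ξ₁ :=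
  not_stablyMem_of_not_symmetric hKR h6a (not_isSymmetric_aokiStandard_one hr hpm hd)

/-- **`(Qⁿₘ)` fails for `n ≥ p − 1` whenever an odd `p ≥ 5` divides `m` with `m/p ≥ 3`, granted the two printed inputs at `m`**: `σ_{p,1} ∈ Mₘ(r+1)`,
`3 ≤ r + 1 ≤ n/2 + 1`, is a Hodge multiset outside `M'ₘ − M'ₘ`. [cite: Shioda1979HodgeFermat, §4 condition (Qⁿₘ), pp. 183–184]
[cite: Shioda1982PicardFermat, Thm K-R (a) p. 730, Thm 6 (a) p. 731] -/
theorem not_conditionQ_of_odd_dvd [NeZero m] {r n : ℕ} (hr : 2 ≤ r) (hpm : 2 * r + 1 ∣ m) (hd : 3 ≤ m / (2 * r + 1))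
    (hn : 2 * r ≤ n) : ¬ ConditionQ m n := fun hQ ↦ by
  have h3 : 3 * (2 * r + 1) ≤ m := (Nat.le_div_iff_mul_le (by omega)).1 hd
  exact not_stablyMem_aokiStandard_one hKR h6a (by omega) hpm hd
    (hQ _ (isHodgeMultiset_aokiStandard_one hpm (by omega)) (by rw [card_aokiStandard_one]; omega)
      (by rw [card_aokiStandard_one]; omega))

/-- **`(Q⁴ₘ)` fails whenever `5 ∣ m`, `m ≥ 15`, granted the two printed inputs at `m`** (theorems in print exactly when `gcd(m, 6) = 1`:
so for `m = 25, 35, 55, 65, 85, 95, 115, 125, 145, …`, in particular every `m = 5p`, `p ≥ 5` prime): Aoki's `σ_{5,1}` is a Hodge sextuple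
outside `M'ₘ − M'ₘ`. Shioda's Appendix is the case `m = 25`. [cite: Shioda1981FermatType, Appendix pp. 78–79]
[cite: Shioda1982PicardFermat, Thm K-R (a) p. 730, Thm 6 (a) p. 731] [cite: Shioda1979HodgeFermat, §4 pp. 183–184] -/
theorem not_conditionQ_four_of_five_dvd [NeZero m] (h5 : 5 ∣ m) (hm : 15 ≤ m) : ¬ ConditionQ m 4 :=
  not_conditionQ_of_odd_dvd hKR h6a (r := 2) le_rfl h5 (by show 3 ≤ m / 5; omega) le_rfl

/-- `(Qₘ)` (all lengths) fails whenever an odd `p ≥ 3` divides `m` with `m/p ≥ 3`, granted the inputs at `m` (for `p = 3` this says the inputs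
are inconsistent with `3 ∣ m`, `m ≥ 9` — indeed Theorem 6 (a) is printed for `gcd(m, 6) = 1` only). [cite: Shioda1979HodgeFermat, §4 condition (Qₘ), p. 183] -/
theorem not_conditionQAll_of_odd_dvd [NeZero m] {r : ℕ} (hr : 1 ≤ r) (hpm : 2 * r + 1 ∣ m) (hd : 3 ≤ m / (2 * r + 1)) :
    ¬ ConditionQAll m := fun hQ ↦ by
  have h3 : 3 * (2 * r + 1) ≤ m := (Nat.le_div_iff_mul_le (by omega)).1 hd
  exact not_stablyMem_aokiStandard_one hKR h6a hr hpm hd (hQ _ (isHodgeMultiset_aokiStandard_one hpm (by omega)))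

/-! ### Shioda's question for `gcd(m, 6) = 1`: `(Qₘ) ⟺ (Pₘ) ⟺ m` prime (granted the inputs at `m`) -/

/-- **`(Qₘ)` holds iff `m` is prime**, for `m` prime to `6`, granted the two printed inputs at `m` (theorems in print for such `m`): if `m` is
prime, `(Pₘ)` holds (Parry's lemma, tree `shiodaCondition_of_prime`) and implies `(Qₘ)`; if `m` is composite, a prime `p ∣ m` (`p ≥ 5`,
`m/p ≥ 5`) gives Aoki's Hodge multiset `σ_{p,1}`, which is not symmetric, while `M'ₘ` is. So Shioda's question "(Qₘ) but not (Pₘ)?"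
[Shioda1979HodgeFermat, p. 184] has a NEGATIVE answer for every `m` prime to `6`; the cell's twenty levels `m ≤ 100` with `(Q⁴ₘ) ∧ ¬(P⁴ₘ)`
are all even. [cite: Shioda1979HodgeFermat, §4 p. 184 (the question)] [cite: Shioda1982PicardFermat, Thm K-R (a) p. 730, Thm 6 (a) p. 731] -/
theorem conditionQAll_iff_prime [NeZero m] (h6 : Nat.Coprime m 6) (h1 : 1 < m) : ConditionQAll m ↔ m.Prime := by
  constructor
  · intro hQ
    by_contra hnp
    -- a prime factor `p` of the composite `m`: `p ≥ 5`, `m / p ≥ 5`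
    obtain ⟨p, hp, hpm⟩ := Nat.exists_prime_and_dvd (show m ≠ 1 by omega)
    have hp2 : p ≠ 2 := by
      rintro rfl
      have : Nat.Coprime 2 6 := Nat.Coprime.coprime_dvd_left hpm h6
      norm_num at this
    have hp3 : p ≠ 3 := by
      rintro rfl
      have : Nat.Coprime 3 6 := Nat.Coprime.coprime_dvd_left hpm h6
      norm_num at this
    have hp5 : 5 ≤ p := by
      have h2 := hp.two_le
      rcases Nat.lt_or_ge p 5 with h | h
      · exfalso
        interval_cases p
        · exact hp2 rfl
        · exact hp3 rfl
        · exact absurd hp (by decide)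
      · exact h
    obtain ⟨d, hd⟩ := hpm
    have hd1 : d ≠ 1 := by rintro rfl; exact hnp (by simpa [hd] using hp)
    have hd0 : d ≠ 0 := by rintro rfl; simp [hd] at h1
    -- `d` is prime to `6` as well, hence `d ≥ 5`
    have hdcop : Nat.Coprime d 6 := Nat.Coprime.coprime_dvd_left ⟨p, by rw [hd, mul_comm]⟩ h6
    have hd2 : d ≠ 2 := by rintro rfl; norm_num at hdcop
    have hd3 : d ≠ 3 := by rintro rfl; norm_num at hdcop
    have hd4 : d ≠ 4 := by rintro rfl; norm_num at hdcop
    have hd5 : 5 ≤ d := by omega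
    have hmp : m / p = d := by rw [hd]; exact Nat.mul_div_cancel_left d hp.pos
    -- `p` is odd: `p = 2r + 1`, `r ≥ 2`
    obtain ⟨r, rfl⟩ := hp.odd_of_ne_two hp2
    exact not_conditionQAll_of_odd_dvd hKR h6a (r := r) (by omega) ⟨d, hd⟩ (by rw [hmp]; omega) hQ
  · intro hp
    haveI : Fact m.Prime := ⟨hp⟩
    exact conditionQAll_of_shiodaCondition shiodaCondition_of_prime

/-- Hence, for `m` prime to `6` and granted the inputs at `m`: **`(Pₘ) ⟺ m` prime** as well (`(Pₘ) ⇒ (Qₘ)` is the tree's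
`conditionQAll_of_shiodaCondition`; the converse is Parry's lemma), so `(Qₘ) ⟺ (Pₘ)`. [cite: Shioda1979HodgeFermat, §4 pp. 183–184] -/
theorem shiodaCondition_iff_prime_of_inputs [NeZero m] (h6 : Nat.Coprime m 6) (h1 : 1 < m) : ShiodaCondition m ↔ m.Prime :=
  ⟨fun hP ↦ (conditionQAll_iff_prime hKR h6a h6 h1).1 (conditionQAll_of_shiodaCondition hP), fun hp ↦ by
    haveI : Fact m.Prime := ⟨hp⟩
    exact shiodaCondition_of_prime⟩

/-- **Shioda's question, `gcd(m, 6) = 1`**: `(Qₘ) ⟺ (Pₘ)`, granted the inputs at `m` — no `m` prime to `6` "satisfies `(Qₘ)` but not `(Pₘ)`".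
[cite: Shioda1979HodgeFermat, §4 p. 184 (the question)] [cite: Shioda1982PicardFermat, Thm K-R (a) p. 730, Thm 6 (a) p. 731] -/
theorem conditionQAll_iff_shiodaCondition_of_inputs [NeZero m] (h6 : Nat.Coprime m 6) (h1 : 1 < m) :
    ConditionQAll m ↔ ShiodaCondition m :=
  (conditionQAll_iff_prime hKR h6a h6 h1).trans (shiodaCondition_iff_prime_of_inputs hKR h6a h6 h1).symm

end Inputs

end Summit.HodgeConjecture.FermatCycles.ConditionQCoprimeSix
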